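import Mathlib
import HarnessLib
import Summits.AtomisticToContinuum.HydrodynamicLimit.Theses.RelayRaceLocality

/-!
# RelayRaceLocality · ConeLocalisation — the FLOORED target of the line `zoomed-bubble-transplant` (definitions)

Support definitions for the crux item `stmt-AtomisticToContinuum-12504` (`ConeLocalisation`, route
RelayRaceLocality of `AtomisticToContinuum/HydrodynamicLimit`), written by its line lead
(prover-line-stmt-AtomisticToContinuum-12504-0, 2026-08-17) so that the registered stubs of the line's skeleton
(`Cruxes/ConeLocalisation/Lines/Sketch.lean`) are precise `Prop`s importable from `Theorems/`.

`ConeLocalisation` is the glue `LightConeInLaw → NearConstantShortTimeHL → S`, `S` = the short-time guarded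
hydrodynamic limit of `RestartPrinciple`'s antecedent (prefix `∃ η₀ ∀ M ∃ τ₁ ∀ profile ∃ σ₀ ∀ σ < σ₀`, guards on `[0,t]`:
packing, `ρ ≤ M`, `θ ∈ [M⁻¹, M]`, `‖u‖ ≤ M`, derivatives of order `≤ 3` bounded by `M` — and NO lower bound on `ρ`).
Three independent analyses on the item (prover note 2026-08-16T08:09, `Cruxes/ConeLocalisation/IdeatorOneNotes.md` §2,
`IdeatorTwoNotes.md` §1, and the lead's `Cruxes/ConeLocalisation/FloorGap.md`) show that no line through the two
hypotheses reaches `S` as typed: `NearConstantShortTimeHL` licenses only comparison gases whose unit-mass density is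
RELATIVELY near-constant, `LightConeInLaw` requires EXACT agreement of reduced data on a ball of radius `≥ c t`, and
admissible deep-ramp data (`log ρ(0,·)` linear of slope `L` on a slab, all absolute derivatives `≤ M`, guards alive up
to `t ≍ δ₀/(Lc)`) are uncoverable at such `t` for every candidate `τ₁(M)`. What localisation DOES prove is `S` with the
density floor `M⁻¹ ≤ ρ s x` added to the guard list — the one-token restatement both ideators recommend for the
consequent of stmt-12504 and the antecedent of stmt-12503 (`closes` is unchanged). This file types exactly that:

* `ShortTimeGuardedHLFloored` — `S♭`: `S` verbatim with `M⁻¹ ≤ ρ s x ∧` inserted after `ρ s x ≤ M ∧`;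
* `ConeLocalisationFloored` — `LightConeInLaw → NearConstantShortTimeHL → S♭` (the crux after the restatement);
* `LocalFlooredLLN` — the LOCAL form of `S♭` the light cone delivers: same prefix with a localisation radius `r = r(M)`
  and an arbitrary finite set `C` of centres fixed BEFORE the profile (so that `σ₀`, a minimum over the comparison
  profiles around the centres, is a finite minimum), concluding the three-field law of large numbers at time `t` for
  every continuous test function vanishing outside `B(c, r)` for some `c ∈ C`;
* `coneLocalisationFloored_of_coneLocalisation : ConeLocalisation → ConeLocalisationFloored` and
  `shortTimeGuardedHLFloored_of_localFlooredLLN`-free sanity `localFlooredLLN_of_shortTimeGuardedHLFloored : S♭ → LocalFlooredLLN`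
  (both by monotonicity: the floored / local statements are formally WEAKER), recording the direction of the gap.

The converse directions are the line: `LocalFlooredLLN → S♭` is the partition-of-unity stub (`stub_assembly`,
`relayRaceLocality_tendstoHydroFieldsAt_of_local`), and `LightConeInLaw → NearConstantShortTimeHL → LocalFlooredLLN`
is the local step (activity-flattened fugacity-matched comparison gas + bubble at scale `r` + cone transfer).
No new mathematical objects; `Prop`s only.
-/

noncomputable section

namespace Summit.AtomisticToContinuum.HydrodynamicLimit.Theorems.ConeLocalisation

open scoped Topology
open Filter Set MeasureTheory
open Literature.MathematicalPhysics.KineticTheory Literature.Analysis.FluidPDE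
  Literature.Analysis.FunctionSpaces
open Summit.AtomisticToContinuum.HydrodynamicLimit.Theses.RelayRaceLocality

/-- **`S♭` — the short-time guarded hydrodynamic limit WITH A DENSITY FLOOR.** Verbatim the consequent `S` of
`RelayRaceLocality.ConeLocalisation` (= the antecedent of `RelayRaceLocality.RestartPrinciple`) with the single extra
guard `M⁻¹ ≤ ρ s x` inserted after `ρ s x ≤ M`: `∃ η₀ ∀ M ∃ τ₁ ∀ (a₀, θ₀, u₀) ∃ σ₀ ∀ σ < σ₀ ∀ classical solutions ∀ flows`,
LLN at `0` ⇒ for `t < min T τ₁` with packing `< η₀`, `M⁻¹ ≤ ρ ≤ M`, `M⁻¹ ≤ θ ≤ M`, `‖u‖ ≤ M` and all derivatives of order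
`≤ 3` of `(ρ, u, θ)` bounded by `M` on `[0, t]`, LLN at `t`. The proposed restated consequent of stmt-12504. [folklore] -/
@[conjecture] def ShortTimeGuardedHLFloored : Prop :=
    ∃ η₀ : ℝ, 0 < η₀ ∧ ∀ M : ℝ, 0 < M → ∃ τ₁ : ℝ, 0 < τ₁ ∧ ∀ (a₀ θ₀ : T3 → ℝ) (u₀ : T3 → V3),
    Continuous a₀ → Continuous θ₀ → Continuous u₀ → (∀ x, 0 < a₀ x) → (∀ x, 0 < θ₀ x) → ∃ σ₀ : ℝ,
    0 < σ₀ ∧ ∀ σ : ℝ, 0 < σ → σ < σ₀ → ∀ (T : ℝ) (ρ θ : ℝ → T3 → ℝ) (u : ℝ → T3 → V3),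
    IsHardSphereEulerSolution σ T ρ u θ → ∀ Φ : (N : ℕ) → HardSphereFlow (Torus.geometry (Fin 3))
    (hsDiameter σ N) (N + 1), TendstoHydroFieldsAt (fun N => localGibbsLaw σ a₀ u₀ θ₀ N (Φ N)) Φ ρ
    u θ 0 → ∀ t ∈ Set.Ico 0 (min T τ₁), (∀ s ∈ Set.Icc 0 t, ∀ x, ρ s x * σ ^ 3 < η₀ ∧ ρ s x ≤ M ∧
    M⁻¹ ≤ ρ s x ∧ θ s x ≤ M ∧ M⁻¹ ≤ θ s x ∧ ‖u s x‖ ≤ M ∧ ∀ i j k : Fin 3, |Torus.partialDeriv i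
    (ρ s) x| ≤ M ∧ ‖Torus.partialDeriv i (u s) x‖ ≤ M ∧ |Torus.partialDeriv i (θ s) x| ≤ M ∧
    |Torus.partialDeriv i (Torus.partialDeriv j (ρ s)) x| ≤ M ∧ ‖Torus.partialDeriv i
    (Torus.partialDeriv j (u s)) x‖ ≤ M ∧ |Torus.partialDeriv i (Torus.partialDeriv j (θ s)) x| ≤
    M ∧ |Torus.partialDeriv i (Torus.partialDeriv j (Torus.partialDeriv k (ρ s))) x| ≤ M ∧
    ‖Torus.partialDeriv i (Torus.partialDeriv j (Torus.partialDeriv k (u s))) x‖ ≤ M ∧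
    |Torus.partialDeriv i (Torus.partialDeriv j (Torus.partialDeriv k (θ s))) x| ≤ M) →
    TendstoHydroFieldsAt (fun N => localGibbsLaw σ a₀ u₀ θ₀ N (Φ N)) Φ ρ u θ t

/-- **The crux after the restatement**: `LightConeInLaw → NearConstantShortTimeHL → S♭`. This is what the line
`zoomed-bubble-transplant` (and every line through the two hypotheses) proves. [folklore] -/
@[conjecture] def ConeLocalisationFloored : Prop :=
  LightConeInLaw → NearConstantShortTimeHL → ShortTimeGuardedHLFloored

/-- **`LocalFlooredLLN` — the local form of `S♭` delivered by the light cone.** Same prefix as `S♭` with, after `τ₁`,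
a localisation radius `r > 0` (a function of `M` only) and an arbitrary FINITE set `C ⊂ 𝕋³` of centres quantified
BEFORE the profile; same hypotheses (LLN at `0`, floored guards on `[0, t]`, `t < min T τ₁`); conclusion: the
three-field law of large numbers at time `t` for every continuous `χ` that vanishes outside the ball
`{x | Torus.euclidDist x c < r}` of SOME centre `c ∈ C`. (`S♭` follows by a partition of unity subordinate to the
`r`-balls of an `r/2`-net `C`: `relayRaceLocality_tendstoHydroFieldsAt_of_local`.) [folklore] -/
@[conjecture] def LocalFlooredLLN : Prop :=
    ∃ η₀ : ℝ, 0 < η₀ ∧ ∀ M : ℝ, 0 < M → ∃ τ₁ : ℝ, 0 < τ₁ ∧ ∃ r : ℝ, 0 < r ∧ ∀ C : Finset T3, ∀ (a₀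
    θ₀ : T3 → ℝ) (u₀ : T3 → V3), Continuous a₀ → Continuous θ₀ → Continuous u₀ → (∀ x, 0 < a₀ x) →
    (∀ x, 0 < θ₀ x) → ∃ σ₀ : ℝ, 0 < σ₀ ∧ ∀ σ : ℝ, 0 < σ → σ < σ₀ → ∀ (T : ℝ) (ρ θ : ℝ → T3 → ℝ) (u
    : ℝ → T3 → V3), IsHardSphereEulerSolution σ T ρ u θ → ∀ Φ : (N : ℕ) → HardSphereFlow
    (Torus.geometry (Fin 3)) (hsDiameter σ N) (N + 1), TendstoHydroFieldsAt (fun N =>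
    localGibbsLaw σ a₀ u₀ θ₀ N (Φ N)) Φ ρ u θ 0 → ∀ t ∈ Set.Ico 0 (min T τ₁), (∀ s ∈ Set.Icc 0 t,
    ∀ x, ρ s x * σ ^ 3 < η₀ ∧ ρ s x ≤ M ∧ M⁻¹ ≤ ρ s x ∧ θ s x ≤ M ∧ M⁻¹ ≤ θ s x ∧ ‖u s x‖ ≤ M ∧ ∀
    i j k : Fin 3, |Torus.partialDeriv i (ρ s) x| ≤ M ∧ ‖Torus.partialDeriv i (u s) x‖ ≤ M ∧
    |Torus.partialDeriv i (θ s) x| ≤ M ∧ |Torus.partialDeriv i (Torus.partialDeriv j (ρ s)) x| ≤ M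
    ∧ ‖Torus.partialDeriv i (Torus.partialDeriv j (u s)) x‖ ≤ M ∧ |Torus.partialDeriv i
    (Torus.partialDeriv j (θ s)) x| ≤ M ∧ |Torus.partialDeriv i (Torus.partialDeriv j
    (Torus.partialDeriv k (ρ s))) x| ≤ M ∧ ‖Torus.partialDeriv i (Torus.partialDeriv j
    (Torus.partialDeriv k (u s))) x‖ ≤ M ∧ |Torus.partialDeriv i (Torus.partialDeriv j
    (Torus.partialDeriv k (θ s))) x| ≤ M) → ∀ χ : T3 → ℝ, Continuous χ → (∃ c ∈ C, ∀ x, r ≤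
    Torus.euclidDist x c → χ x = 0) → ∀ δ : ℝ, 0 < δ → Tendsto (fun N => localGibbsLaw σ a₀ u₀ θ₀
    N (Φ N) {z | δ < |empiricalDensityField ((Φ N).flow t z) χ - ∫ x, χ x * ρ t x|}) atTop (nhds
    0) ∧ Tendsto (fun N => localGibbsLaw σ a₀ u₀ θ₀ N (Φ N) {z | δ < ‖empiricalMomentumField ((Φ
    N).flow t z) χ - ∫ x, (χ x * ρ t x) • u t x‖}) atTop (nhds 0) ∧ Tendsto (fun N =>
    localGibbsLaw σ a₀ u₀ θ₀ N (Φ N) {z | δ < |empiricalEnergyField ((Φ N).flow t z) χ - ∫ x, χ x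
    * totalEnergyDensity (ρ t x) (u t x) (θ t x)|}) atTop (nhds 0)

/-- `ConeLocalisation → ConeLocalisationFloored`: the floored target is formally WEAKER than the crux as typed (drop the
floor guard). The converse is the density-floor gap (`Cruxes/ConeLocalisation/FloorGap.md`). [folklore] -/
theorem coneLocalisationFloored_of_coneLocalisation (h : ConeLocalisation) : ConeLocalisationFloored := by
  intro hA hB
  obtain ⟨η₀, hη₀, H⟩ := h hA hB
  refine ⟨η₀, hη₀, fun M hM => ?_⟩
  obtain ⟨τ₁, hτ₁, H1⟩ := H M hM
  refine ⟨τ₁, hτ₁, fun a₀ θ₀ u₀ ha hθ hu ha0 hθ0 => ?_⟩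
  obtain ⟨σ₀, hσ₀, H2⟩ := H1 a₀ θ₀ u₀ ha hθ hu ha0 hθ0
  refine ⟨σ₀, hσ₀, fun σ hσ hσ' T ρ θ u hE Φ h0 t ht hg => ?_⟩
  exact H2 σ hσ hσ' T ρ θ u hE Φ h0 t ht fun s hs x => ⟨(hg s hs x).1, (hg s hs x).2.1, (hg s hs x).2.2.2⟩

/-- `S♭ → LocalFlooredLLN` (take `r := 1` and ignore the support clause): the local statement is formally WEAKER than
`S♭`; the line proves the converse by a partition of unity (`stub_assembly`). [folklore] -/
theorem localFlooredLLN_of_shortTimeGuardedHLFloored (h : ShortTimeGuardedHLFloored) : LocalFlooredLLN := by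
  obtain ⟨η₀, hη₀, H⟩ := h
  refine ⟨η₀, hη₀, fun M hM => ?_⟩
  obtain ⟨τ₁, hτ₁, H1⟩ := H M hM
  refine ⟨τ₁, hτ₁, 1, one_pos, fun C a₀ θ₀ u₀ ha hθ hu ha0 hθ0 => ?_⟩
  obtain ⟨σ₀, hσ₀, H2⟩ := H1 a₀ θ₀ u₀ ha hθ hu ha0 hθ0
  refine ⟨σ₀, hσ₀, fun σ hσ hσ' T ρ θ u hE Φ h0 t ht hg χ hχ _ δ hδ => ?_⟩
  exact H2 σ hσ hσ' T ρ θ u hE Φ h0 t ht hg χ hχ δ hδ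

end Summit.AtomisticToContinuum.HydrodynamicLimit.Theorems.ConeLocalisation

end
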